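import Mathlib
import HarnessLib
import Literature.MathematicalPhysics.QuantumLattice.HubbardBandSectorCountingToolbox
import Summits.HubbardSuperconductivity.HubbardSuperconductivity.Theorems.KLProgrammeH10TwoPointLimitSymbolCellGeometry

/-!
# Route `KLProgramme` — ENGINE child gen 8 (stmt-HubbardSuperconductivity-20437 `KLRegimeEngineV17F2`), skeleton v2 class #3 witness input GAP L2-c:
# torus momenta of a THIN shell `{|e| ≤ η}` inside a coordinate box of half-width `ρ` — the SAGITTA-FREE count `O(η·ρ·L² + (η + ρ)·L + 1)`
# (cell gate-hubbard-kl, seat hubbard-kl-k3c2-p2 g9, value/(T) lane)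

`card_filter_cell_le` (…SymbolCellGeometry, BGM (2.46)–(2.50)) counts the momenta of the cell `{‖p − p_F‖ ≤ ρ, |e(p)| ≤ Λ}` through ONE rotated
rectangle, of normal extent `(Λ + K₂ρ²)/γ`: the sagitta `K₂ρ²` of the Fermi curve across the cell.  For the β-UNIFORM entry bound of the SOFT
covariance (…SoftCovSectorEntrySharp, `norm_entry_sectorSub_klSoftCov_le_of_annulusCount`) the shell thickness runs over the dyadic radii
`r ∈ [π/β, Λ_n]`, far below `ρ² ≍ w_n²`, and the sagitta term would cost a `log β`.  This file counts the same cell along the COORDINATE FIBRES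
of the lattice instead (the device of `Literature/…/ThinShellMomentumCount`, restricted to a box): on each fibre `e` is monotone with slope `≥ λ`
wherever one of its partial derivatives is `≥ λ`, so the fibre carries `O(ηL/λ + 1)` shell momenta (`gridCount_L2` of the BGM toolbox, Lipschitz
constant `K₂` of `∂ᵢe` from `‖D²e‖ ≤ K₂`), and only the `ρL/π + 1` fibres meeting the box contribute:

* §1 `intCard_le_of_diam`, `card_le_of_injOn_int_window` — integers in a window;
* §2 `hasDerivAt_comp_line'`, `abs_fderiv_fibre_sub_fibre_le` — fibre calculus of a `C²` function on `Fin 2 → ℝ` (sup norm);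
* §3 **`card_filter_shell_box_le`** — for `e ∈ C²` with `‖D²e‖ ≤ K₂` (`K₂ > 0`), a finite set `S` of torus momenta `p̃_k = 2πk̃/L` with
  `|e(p̃_k)| ≤ η`, `‖p̃_k − c‖ ≤ ρ` and a coordinate-gradient floor `λ ≤ |∂₀e(p̃_k)| ∨ λ ≤ |∂₁e(p̃_k)|` at every counted point has
  `#S ≤ 2·(ρL/π + 1)·(8πK₂/λ + 1)·(4ηL/(πλ) + 2)` — area `η × ρ`, no `ρ²`.

Everything is proved; no definitions, no named facts. [folklore]  (The coordinate-gradient floor is supplied, for the frame band `e_K`, by clause (i)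
`GeomConstants (frameLevel μ K) 7 (3/80) (1/2) (3/200)` of `FrameOK`: `|∇e_K| ≥ 1/2` on `{|e_K| < 3/80}` ⇒ `λ = 1/(2√2)`.)
-/

noncomputable section

namespace Summit.HubbardSuperconductivity.HubbardSuperconductivity.Theorems.TorusFourierL2

set_option linter.dupNamespace false -- summit = problem name (single-conjunct summit), D-0017

open Set Finset Literature.Probability.LatticeModels Literature.MathematicalPhysics.QuantumLattice.BandSectorCounting
open scoped Real

/-! ### §1 Integers in a window -/

/-- A finite set of integers whose elements are pairwise within `D` (as reals) has at most `D + 1` elements. [folklore] -/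
theorem intCard_le_of_diam {S : Finset ℤ} {D : ℝ} (hD : 0 ≤ D)
    (h : ∀ i ∈ S, ∀ j ∈ S, (j : ℝ) - i ≤ D) : (S.card : ℝ) ≤ D + 1 := by
  rcases S.eq_empty_or_nonempty with rfl | hne
  · simp; linarith
  · set m := S.min' hne with hm
    have hsub : S ⊆ Finset.Icc m (m + ⌊D⌋) := by
      intro j hj
      rw [Finset.mem_Icc]
      refine ⟨S.min'_le j hj, ?_⟩
      have h1 := h m (S.min'_mem hne) j hj
      have h2 : ((j - m : ℤ) : ℝ) ≤ D := by push_cast; linarith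
      have h3 : j - m ≤ ⌊D⌋ := Int.le_floor.2 h2
      omega
    have h0 : 0 ≤ ⌊D⌋ := Int.floor_nonneg.2 hD
    calc (S.card : ℝ) ≤ ((Finset.Icc m (m + ⌊D⌋)).card : ℝ) := by exact_mod_cast Finset.card_le_card hsub
      _ = ((⌊D⌋ + 1).toNat : ℝ) := by rw [Int.card_Icc]; congr 2; ring
      _ = ((⌊D⌋ + 1 : ℤ) : ℝ) := by exact_mod_cast Int.toNat_of_nonneg (by omega)
      _ ≤ D + 1 := by push_cast; linarith [Int.floor_le D]

/-- **Integers in a window**: if `φ` injects the finite set `S` into `ℤ` with `|h·φ(a) − c| ≤ ρ` on `S` (`h > 0`), then `#S ≤ 2ρ/h + 1`. [folklore] -/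
theorem card_le_of_injOn_int_window {α : Type*} (S : Finset α) (φ : α → ℤ) (hφ : Set.InjOn φ S) {h c ρ : ℝ} (hh : 0 < h)
    (hρ : 0 ≤ ρ) (hw : ∀ a ∈ S, |h * (φ a : ℝ) - c| ≤ ρ) : (S.card : ℝ) ≤ 2 * ρ / h + 1 := by
  classical
  rw [← Finset.card_image_of_injOn hφ]
  refine intCard_le_of_diam (by positivity) fun i hi j hj => ?_
  obtain ⟨a, ha, rfl⟩ := Finset.mem_image.1 hi
  obtain ⟨b, hb, rfl⟩ := Finset.mem_image.1 hj
  have h1 := (abs_le.1 (hw a ha)).1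
  have h2 := (abs_le.1 (hw b hb)).2
  rw [le_div_iff₀ hh]
  have : ((φ b : ℝ) - φ a) * h = h * (φ b : ℝ) - h * (φ a : ℝ) := by ring
  rw [this]; linarith

/-! ### §2 Fibre calculus of a `C²` function on `Fin 2 → ℝ` -/

section Fibre

variable {e : (Fin 2 → ℝ) → ℝ}

/-- Along the line `s ↦ c + s • v`, `e` has derivative `De(c + t v)[v]`. [folklore] -/
theorem hasDerivAt_comp_line' (he : ContDiff ℝ 2 e) (c v : Fin 2 → ℝ) (t : ℝ) :
    HasDerivAt (fun s : ℝ => e (c + s • v)) (fderiv ℝ e (c + t • v) v) t := by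
  have hl : HasDerivAt (fun s : ℝ => c + s • v) v t := by
    simpa using ((hasDerivAt_id t).smul_const v).const_add c
  have hd : DifferentiableAt ℝ e (c + t • v) := (he.differentiable (by simp)).differentiableAt
  exact hd.hasFDerivAt.comp_hasDerivAt t hl

/-- The fibre derivative `s ↦ De(c + s v)[v]` is `K₂`-Lipschitz when `‖D²e‖ ≤ K₂` and `‖v‖ = 1`. [folklore] -/
theorem abs_fderiv_fibre_sub_fibre_le (he : ContDiff ℝ 2 e) {K₂ : ℝ} (hK₂ : ∀ p, ‖iteratedFDeriv ℝ 2 e p‖ ≤ K₂) (c v : Fin 2 → ℝ)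
    (hv : ‖v‖ = 1) (z z' : ℝ) :
    |fderiv ℝ e (c + z • v) v - fderiv ℝ e (c + z' • v) v| ≤ K₂ * |z - z'| := by
  have h := abs_fderiv_apply_sub_le he hK₂ (c + z • v) (c + z' • v) v
  have hn : ‖(c + z • v) - (c + z' • v)‖ = |z - z'| := by
    rw [show (c + z • v) - (c + z' • v) = (z - z') • v by rw [sub_smul]; abel, norm_smul, hv, mul_one, Real.norm_eq_abs]
  rw [hn, hv, mul_one] at h
  exact h

end Fibre

/-! ### §3 The sagitta-free count of a thin shell inside a coordinate box -/

/-- **Torus momenta of a thin shell inside a box, counted along coordinate fibres.**  Let `e ∈ C²(ℝ²)` (sup norm on `Fin 2 → ℝ`) with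
`‖D²e‖ ≤ K₂`, `K₂ > 0`, and let `S` be a finite set of torus sites `k ∈ (ℤ/L)²` whose centred momenta `p̃_k = 2πk̃/L` satisfy `|e(p̃_k)| ≤ η`,
`‖p̃_k − c‖ ≤ ρ` and the coordinate-gradient floor `λ ≤ |∂₀e(p̃_k)|` or `λ ≤ |∂₁e(p̃_k)|`.  Then
`#S ≤ 2·(ρL/π + 1)·(8πK₂/λ + 1)·(4ηL/(πλ) + 2)`: the area `η·ρ` of the curved box, with NO sagitta term `K₂ρ²`
(contrast `card_filter_cell_le`). [cite: BenfattoGiulianiMastropietro2006, §2.5 (2.46)–(2.50)] -/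
theorem card_filter_shell_box_le (L : ℕ) [NeZero L] {e : (Fin 2 → ℝ) → ℝ} (he : ContDiff ℝ 2 e) {K₂ : ℝ} (hK₂pos : 0 < K₂)
    (hK₂ : ∀ p, ‖iteratedFDeriv ℝ 2 e p‖ ≤ K₂) {η lam ρ : ℝ} (hη : 0 ≤ η) (hlam : 0 < lam) (hρ : 0 ≤ ρ) (c : Fin 2 → ℝ)
    (S : Finset (TorusSite 2 L))
    (hS : ∀ k ∈ S, |e (fun j => 2 * π * (((k j).valMinAbs : ℤ) : ℝ) / L)| ≤ η ∧
      ‖(fun j => 2 * π * (((k j).valMinAbs : ℤ) : ℝ) / L) - c‖ ≤ ρ)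
    (hgrad : ∀ k ∈ S, lam ≤ |fderiv ℝ e (fun j => 2 * π * (((k j).valMinAbs : ℤ) : ℝ) / L) (Pi.single 0 1)| ∨
      lam ≤ |fderiv ℝ e (fun j => 2 * π * (((k j).valMinAbs : ℤ) : ℝ) / L) (Pi.single 1 1)|) :
    (S.card : ℝ) ≤ 2 * (ρ * L / π + 1) * ((8 * π * K₂ / lam + 1) * (4 * η * L / (π * lam) + 2)) := by
  classical
  have hLpos : (0 : ℝ) < L := Nat.cast_pos.2 (Nat.pos_of_ne_zero (NeZero.ne L))
  have hπ := Real.pi_pos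
  set w : ℝ := 2 * π / L with hw_def
  have hw : 0 < w := by rw [hw_def]; positivity
  set H : ℕ := L / 2 with hH_def
  set x₀ : ℝ := -(2 * π * (H : ℝ) / L) with hx₀_def
  set N : ℕ := L + 1 with hN_def
  set pt : TorusSite 2 L → (Fin 2 → ℝ) := fun k j => 2 * π * (((k j).valMinAbs : ℤ) : ℝ) / L with hpt_def
  -- the per-fibre constant and its closed-form majorant
  set Bf : ℝ := (N * w / (lam / (2 * K₂)) + 1) * (2 * ((4 * η / lam) / w + 1)) with hBf_def
  have hBf : Bf ≤ (8 * π * K₂ / lam + 1) * (4 * η * L / (π * lam) + 2) := by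
    have h1 : (N : ℝ) * w / (lam / (2 * K₂)) ≤ 8 * π * K₂ / lam := by
      have hNw : (N : ℝ) * w ≤ 4 * π := by
        rw [hN_def, hw_def]; push_cast
        rw [show ((L : ℝ) + 1) * (2 * π / L) = 2 * π * ((L + 1) / L) by field_simp]
        have hL1 : (1 : ℝ) ≤ L := by exact_mod_cast Nat.pos_of_ne_zero (NeZero.ne L)
        have : ((L : ℝ) + 1) / L ≤ 2 := by rw [div_le_iff₀ hLpos]; linarith
        nlinarith [this, hπ]
      calc (N : ℝ) * w / (lam / (2 * K₂)) = (N : ℝ) * w * (2 * K₂ / lam) := by field_simp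
        _ ≤ 4 * π * (2 * K₂ / lam) := mul_le_mul_of_nonneg_right hNw (by positivity)
        _ = 8 * π * K₂ / lam := by ring
    have h2 : 2 * ((4 * η / lam) / w + 1) = 4 * η * L / (π * lam) + 2 := by
      rw [hw_def]; field_simp
    rw [hBf_def, h2]
    exact mul_le_mul_of_nonneg_right (by linarith) (by positivity)
  -- the count in ONE direction `i`, transverse coordinate `i'`
  have key : ∀ i i' : Fin 2, i ≠ i' → (∀ j : Fin 2, j = i ∨ j = i') →
      (((S.filter fun k => lam ≤ |fderiv ℝ e (pt k) (Pi.single i 1)|).card : ℝ)) ≤ (ρ * L / π + 1) * Bf := by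
    intro i i' hii' hcov
    set v : Fin 2 → ℝ := Pi.single i 1 with hv_def
    have hv : ‖v‖ = 1 := by rw [hv_def, Pi.norm_single, norm_one]
    set base : ZMod L → (Fin 2 → ℝ) := fun t => Pi.single i' (2 * π * ((t.valMinAbs : ℤ) : ℝ) / L) with hbase_def
    set G : ZMod L → ℝ → ℝ := fun t s => e (base t + s • v) with hG_def
    set G' : ZMod L → ℝ → ℝ := fun t s => fderiv ℝ e (base t + s • v) v with hG'_def
    -- the centred momentum on the fibre through its transverse coordinate
    have hpt : ∀ k : TorusSite 2 L, pt k = base (k i') + (2 * π * (((k i).valMinAbs : ℤ) : ℝ) / L) • v := by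
      intro k; funext j
      simp only [hpt_def, hbase_def, hv_def, Pi.add_apply, Pi.smul_apply, Pi.single_apply, smul_eq_mul]
      rcases hcov j with rfl | rfl
      · simp [hii']
      · simp [hii'.symm]
    -- per-fibre count (`gridCount_L2` on `N = L + 1` grid points `x₀ + j w`, `j ≤ L`)
    have hfib : ∀ t : ZMod L, ((((Finset.range N).filter fun j : ℕ =>
        |G t (x₀ + j * w)| ≤ η ∧ lam ≤ |G' t (x₀ + j * w)|).card : ℝ)) ≤ Bf := fun t =>
      gridCount_L2 (g := G t) (g' := G' t) (fun z => hasDerivAt_comp_line' he _ _ z) hK₂pos hlam hη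
        (fun z z' => abs_fderiv_fibre_sub_fibre_le he hK₂ _ _ hv z z') hw N
    -- the transverse coordinates occurring: at most `ρL/π + 1`
    set A : Finset (ZMod L) := S.image fun k => k i' with hA_def
    have hA : (A.card : ℝ) ≤ ρ * L / π + 1 := by
      have h := card_le_of_injOn_int_window A (fun t : ZMod L => t.valMinAbs) (fun t _ t' _ htt => ZMod.valMinAbs_inj.1 htt)
        (h := 2 * π / L) (c := c i') (ρ := ρ) (by positivity) hρ ?_
      · refine h.trans (le_of_eq ?_); field_simp
      · intro t ht
        obtain ⟨k, hk, rfl⟩ := Finset.mem_image.1 ht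
        have hbox := (hS k hk).2
        have := norm_le_pi_norm ((fun j => 2 * π * (((k j).valMinAbs : ℤ) : ℝ) / L) - c) i'
        simp only [Pi.sub_apply, Real.norm_eq_abs] at this
        rw [show 2 * π / L * (((k i').valMinAbs : ℤ) : ℝ) = 2 * π * (((k i').valMinAbs : ℤ) : ℝ) / L by ring]
        exact this.trans hbox
    -- the index map into `A × range N`
    have hvH : ∀ x : ZMod L, 0 ≤ x.valMinAbs + H ∧ x.valMinAbs + H ≤ (L : ℤ) := by
      intro x
      have h := ZMod.natAbs_valMinAbs_le x
      have h1 : -(H : ℤ) ≤ x.valMinAbs ∧ x.valMinAbs ≤ H := by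
        rw [hH_def]; constructor <;> omega
      have h2 : 2 * (H : ℤ) ≤ L := by rw [hH_def]; omega
      constructor <;> omega
    let f : TorusSite 2 L → ZMod L × ℕ := fun k => (k i', ((k i).valMinAbs + H).toNat)
    set T := (A ×ˢ Finset.range N).filter fun tj : ZMod L × ℕ =>
        |G tj.1 (x₀ + tj.2 * w)| ≤ η ∧ lam ≤ |G' tj.1 (x₀ + tj.2 * w)| with hT_def
    have hgrid : ∀ k : TorusSite 2 L, x₀ + ((((k i).valMinAbs + H).toNat : ℕ) : ℝ) * w = 2 * π * (((k i).valMinAbs : ℤ) : ℝ) / L := by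
      intro k
      have h0 := (hvH (k i)).1
      have hcast : ((((k i).valMinAbs + H).toNat : ℕ) : ℝ) = (((k i).valMinAbs : ℤ) : ℝ) + H := by
        have : ((((k i).valMinAbs + H).toNat : ℕ) : ℤ) = (k i).valMinAbs + H := Int.toNat_of_nonneg h0
        exact_mod_cast this
      rw [hcast, hx₀_def, hw_def]; field_simp; ring
    have hST : (S.filter fun k => lam ≤ |fderiv ℝ e (pt k) (Pi.single i 1)|).card ≤ T.card := by
      refine Finset.card_le_card_of_injOn f (fun k hk => ?_) (fun k hk k' hk' hkk => ?_)
      · rw [Finset.mem_coe, Finset.mem_filter] at hk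
        rw [Finset.mem_coe, hT_def, Finset.mem_filter, Finset.mem_product, Finset.mem_range]
        refine ⟨⟨Finset.mem_image.2 ⟨k, hk.1, rfl⟩, ?_⟩, ?_, ?_⟩
        · show ((k i).valMinAbs + H).toNat < N
          have := (hvH (k i)).2; rw [hN_def]; omega
        · show |e (base (k i') + (x₀ + ((((k i).valMinAbs + H).toNat : ℕ) : ℝ) * w) • v)| ≤ η
          rw [hgrid k, ← hpt k]; exact (hS k hk.1).1
        · show lam ≤ |fderiv ℝ e (base (k i') + (x₀ + ((((k i).valMinAbs + H).toNat : ℕ) : ℝ) * w) • v) v|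
          rw [hgrid k, ← hpt k]; exact hk.2
      · simp only [f, Prod.mk.injEq] at hkk
        obtain ⟨h1, h2⟩ := hkk
        have h3 : (k i).valMinAbs + H = (k' i).valMinAbs + H := by
          have := congrArg (fun n : ℕ => (n : ℤ)) h2
          simpa only [Int.toNat_of_nonneg (hvH (k i)).1, Int.toNat_of_nonneg (hvH (k' i)).1] using this
        have h4 : k i = k' i := ZMod.valMinAbs_inj.1 (by omega)
        funext j
        rcases hcov j with rfl | rfl
        · exact h4
        · exact h1
    have hT : (T.card : ℝ) ≤ A.card * Bf := by
      have hc : T.card = ∑ t ∈ A, ((Finset.range N).filter fun j : ℕ =>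
          |G t (x₀ + j * w)| ≤ η ∧ lam ≤ |G' t (x₀ + j * w)|).card := by
        rw [hT_def, Finset.card_filter, Finset.sum_product]
        refine Finset.sum_congr rfl fun t _ => ?_
        rw [Finset.card_filter]
      rw [hc]; push_cast
      calc ∑ t ∈ A, ((((Finset.range N).filter fun j : ℕ => |G t (x₀ + j * w)| ≤ η ∧ lam ≤ |G' t (x₀ + j * w)|).card : ℝ))
          ≤ ∑ t ∈ A, Bf := Finset.sum_le_sum fun t _ => hfib t
        _ = A.card * Bf := by rw [Finset.sum_const, nsmul_eq_mul]
    have hBf0 : 0 ≤ Bf := by rw [hBf_def]; positivity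
    calc (((S.filter fun k => lam ≤ |fderiv ℝ e (pt k) (Pi.single i 1)|).card : ℝ)) ≤ T.card := by exact_mod_cast hST
      _ ≤ A.card * Bf := hT
      _ ≤ (ρ * L / π + 1) * Bf := mul_le_mul_of_nonneg_right hA hBf0
  -- cover `S` by the two directional sets and add
  have hcover : S ⊆ (S.filter fun k => lam ≤ |fderiv ℝ e (pt k) (Pi.single 0 1)|) ∪
      (S.filter fun k => lam ≤ |fderiv ℝ e (pt k) (Pi.single 1 1)|) := by
    intro k hk
    rcases hgrad k hk with h | h
    · exact Finset.mem_union.2 (Or.inl (Finset.mem_filter.2 ⟨hk, h⟩))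
    · exact Finset.mem_union.2 (Or.inr (Finset.mem_filter.2 ⟨hk, h⟩))
  have h0 := key 0 1 (by decide) (fun j => by fin_cases j <;> simp)
  have h1 := key 1 0 (by decide) (fun j => by fin_cases j <;> simp)
  have hBf0 : 0 ≤ Bf := by rw [hBf_def]; positivity
  have hsum : (S.card : ℝ) ≤ 2 * ((ρ * L / π + 1) * Bf) := by
    have := (Finset.card_le_card hcover).trans (Finset.card_union_le _ _)
    have h' : (S.card : ℝ) ≤ (((S.filter fun k => lam ≤ |fderiv ℝ e (pt k) (Pi.single 0 1)|).card : ℝ)) +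
        (((S.filter fun k => lam ≤ |fderiv ℝ e (pt k) (Pi.single 1 1)|).card : ℝ)) := by exact_mod_cast this
    linarith
  calc (S.card : ℝ) ≤ 2 * ((ρ * L / π + 1) * Bf) := hsum
    _ ≤ 2 * ((ρ * L / π + 1) * ((8 * π * K₂ / lam + 1) * (4 * η * L / (π * lam) + 2))) := by
        have hρL : 0 ≤ ρ * L / π + 1 := by positivity
        nlinarith [mul_le_mul_of_nonneg_left hBf hρL]
    _ = _ := by ring

end Summit.HubbardSuperconductivity.HubbardSuperconductivity.Theorems.TorusFourierL2

end
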